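import Summits.QuantumFields.YangMills.Theorems.SwapVirialDeficitBlowUpPeriodicHub
import Summits.QuantumFields.YangMills.Theorems.ToronValleyVolumePeriodicRingCeilingBox
import Summits.QuantumFields.YangMills.Theorems.SwapVirialDeficitBlowUpFollowerBox
import Summits.QuantumFields.YangMills.Theorems.SwapVirialDeficitSwapRingSectorEvents
import HarnessLib

/-!
# The PERIODIC massive-mode rung, brick PD-I: the periodic toron BOX in chart and blow-up coordinates — leaders pairwise nearly commuting,
# followers boxed
# (free-hands support of ⟨stmt-QuantumFields-24196⟩ `SwapVirialDeficit.ToronSoftnessSharp`; memo `w3-g64-memo-24196-periodic-massive-mode-rung.md` §2 PD;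
# periodic twin of w2 g57's ✓`BlowUpRing.chartBox_of_chartDeficit`; consumes ✓`ToronValleyVolume…commBox_of_ringDeficit`, ✓`BlowUp.follower_box`)

The deep and outer hypotheses of the log-squeeze lemma (✓`BlowUp.tendsto_div_log_of_twoScale`) for the periodic kernel (✓PH `BlowUpRing.periodicKernel`)
need NO new geometry: a small periodic deficit forces the four leaders to commute pairwise up to `20L²√F` and every follower within `12L²√F` of the
identity (✓`commBox_of_ringDeficit`), so the periodic fibre event sits inside (K4 leader event at threshold `R·t`) × (follower boxes).  This file is the
coordinate translation:
* §1 ★★ `periodicChartBox_of_chartDeficit` — in chart coordinates `(C, U)` (principal sector, `χ ≡ 1`), with `δ = periodicChartDeficit 0 1 (C, U)`: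
  `∀ k l : Fin 4, ‖q(C k) q(C l) − q(C l) q(C k)‖ ≤ 20L²√δ` (ALL FOUR letters, quaternion norm; `q = su2Quat`) and `∀ i, ‖U_i − 1‖_F ≤ 12L²√δ`;
* §2 ★★ `section_periodicBlowUpSet_subset` — in blow-up coordinates at scale `t`, level `s = r·t²` (`r ≥ 0`): the section of `periodicBlowUpSet 0 1 t (r t²)`
  at `(a, w)` is contained in `{y | ∀ i, ‖D³_t y_i‖ < 1 ∧ ‖Q(D³_t y_i) − 1‖_F ≤ (12L²√r)·t}`, and is EMPTY unless the leaders `axialLetters (a, dil3P t w)` lie in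
  `nearlyCommuting ((20L²√r)·t)` with `dil3P t w ∈ ball3`;
* §3 ★ `volume_pi_followerSection_le` — hence `vol^{Fol}(section) ≤ vol^{Fol}{y | ∀ i, |y_i.re| < 1 ∧ ‖Im y_i‖ ≤ 12L²√r} < ∞` (✓`BlowUp.follower_box`, off the
  null set `∃ i, y_i = 0`; ✓`pi_volume_followerBox_ne_top`), uniformly in `t ∈ (0, t₀]`.
Part PD-II (`…BlowUpPeriodicDominator`): the leader event's volume is `R⁶·hubFun (R t) a₀ ρ²` (K4 ✓`dilate3_mem_fourSet_iff`, ✓`volume_rescaledSet4_eq_twoScale`),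
whence `periodicKernel ≤ const·radK (R t)` and the deep/outer bounds from fcl-p3 g44's ✓`lintegral_radK_deep_le` / ✓`lintegral_radK_outer_le`.
HONEST LABEL: coordinate bookkeeping (plumbing for a plan-level fixed-`L` rung of a DRAFT line); NOT ⟨24196⟩/⟨24497⟩; own crux ⟨22884⟩ OPEN (blocked-on
⟨19935⟩); the Yang–Mills mass gap is NOT proved; no summit is proved by a line.
Width seat ym-line-sfw-p2-w3 g64 (cell ym-idea-1, free hands), `--supports stmt-QuantumFields-24196`.  THEOREMS ONLY (0 `def`, 0 `sorry`), standard axioms.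
References: [cite: Luscher1983, §2]; [cite: tHooft1979]; [folklore].
-/

set_option autoImplicit false

noncomputable section

open MeasureTheory Quaternion Set
open scoped Quaternion ENNReal BigOperators
open Literature.MathematicalPhysics.QuantumLattice
open Literature.MathematicalPhysics.QuantumFieldTheory hiding SU2
open Summit.QuantumFields.YangMills.Theorems.SwapTwistDeficit.ToronLog

attribute [local instance] Literature.Analysis.FluidPDE.Tao2016.quatMeasurableSpace
  Literature.Analysis.FluidPDE.Tao2016.quatBorelSpace
  Literature.MathematicalPhysics.QuantumLattice.secondCountableTopology_su2

namespace Summit.QuantumFields.YangMills.Theorems.SwapVirialDeficit.BlowUpRing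

open Summit.QuantumFields.YangMills.Theorems.FemtoTransferGap
open Summit.QuantumFields.YangMills.Theorems.FemtoTransferGap.TT
open Summit.QuantumFields.YangMills.Theorems.VirialFluxGap.RingDeficit
open Summit.QuantumFields.YangMills.Theorems.ToronValleyVolume.PeriodicRingCeiling (commBox_of_ringDeficit)
open Summit.QuantumFields.YangMills.Theorems.SwapVirialDeficit.SwapRingSectors (norm_quat_comm_le_of_frob)
open Summit.QuantumFields.YangMills.Theorems.SwapVirialDeficit.ZeroModeSigma (ball3 measurableSet_ball3 dilateIm continuous_dilateIm)
open Summit.QuantumFields.YangMills.Theorems.SwapVirialDeficit.BlowUp (axialLetters dil3P follower_box pi_volume_followerBox_ne_top)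

variable {L : ℕ} [NeZero L]

/-! ## §1 The periodic toron box in chart coordinates -/

/-- ★★ **THE PERIODIC TORON BOX IN CHART COORDINATES** (principal sector, `χ ≡ 1`): with `δ = periodicChartDeficit 0 1 (C, U)`, ALL FOUR leaders commute
pairwise up to `20L²√δ` in quaternion norm (the hub `c = C 3` included: the periodic seam does NOT twist), and every follower is within `12L²√δ` of the
identity — the relative coordinates of ✓`commBox_of_ringDeficit`. [cite: Luscher1983, §2] [cite: tHooft1979] -/
theorem periodicChartBox_of_chartDeficit (q : (Fin 4 → SU2) × (Fol L → SU2)) :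
    (∀ k l : Fin 4, ‖su2Quat (q.1 k) * su2Quat (q.1 l) - su2Quat (q.1 l) * su2Quat (q.1 k)‖ ≤
      20 * (L : ℝ) ^ 2 * Real.sqrt (periodicChartDeficit L (fun _ => false) (fun _ => 1) q)) ∧
    (∀ i : Fol L, frobNorm (((q.2 i : SU2) : Matrix (Fin 2) (Fin 2) ℂ) - 1) ≤
      12 * (L : ℝ) ^ 2 * Real.sqrt (periodicChartDeficit L (fun _ => false) (fun _ => 1) q)) := by
  obtain ⟨hCC, hcC, hw, hr, hg⟩ := commBox_of_ringDeficit (ringConfig (fun _ => 1) q).1 (ringConfig (fun _ => 1) q).2.1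
    (ringConfig (fun _ => 1) q).2.2
  have hF : ringDeficit L (fun _ => false) ((Fin.cons (glue (ringConfig (fun _ => 1) q).1) (ringConfig (fun _ => 1) q).2.1 :
      Fin (2 * L - 1 + 1) → GaugeConfig 3 L SU2), (ringConfig (fun _ => 1) q).2.2) = periodicChartDeficit L (fun _ => false) (fun _ => 1) q := rfl
  simp only [hF, ringConfig_fst_lead, ringConfig_snd_snd_zero] at hCC hcC hw hr hg
  set s : ℝ := 20 * (L : ℝ) ^ 2 * Real.sqrt (periodicChartDeficit L (fun _ => false) (fun _ => 1) q) with hs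
  refine ⟨?_, fun i => ?_⟩
  · -- all four letters: pair letters from `hCC`, hub–letter from `hcC`, symmetry and the diagonal
    have hs0 : 0 ≤ s := by positivity
    have hA : ∀ μ ν : Fin 3, ‖su2Quat (q.1 (Fin.castSucc μ)) * su2Quat (q.1 (Fin.castSucc ν)) -
        su2Quat (q.1 (Fin.castSucc ν)) * su2Quat (q.1 (Fin.castSucc μ))‖ ≤ s := fun μ ν => norm_quat_comm_le_of_frob (hCC μ ν)
    have hB : ∀ μ : Fin 3, ‖su2Quat (q.1 (Fin.last 3)) * su2Quat (q.1 (Fin.castSucc μ)) -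
        su2Quat (q.1 (Fin.castSucc μ)) * su2Quat (q.1 (Fin.last 3))‖ ≤ s := fun μ => norm_quat_comm_le_of_frob (hcC μ)
    intro k l
    rcases Fin.eq_castSucc_or_eq_last k with ⟨μ, rfl⟩ | rfl <;> rcases Fin.eq_castSucc_or_eq_last l with ⟨ν, rfl⟩ | rfl
    · exact hA μ ν
    · rw [norm_sub_rev]; exact hB μ
    · exact hB ν
    · rw [sub_self, norm_zero]; exact hs0
  · rcases i with i | ⟨j, e⟩ | x
    · have h := hw i.1
      rw [ringConfig_fst_of_not_isLead] at h
      have hl : (if i.1.1.1 i.1.1.2 = -1 then q.1 (Fin.castSucc i.1.1.2) else 1) = letter (fun μ => q.1 (Fin.castSucc μ)) i.1 := rfl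
      rwa [hl, inv_mul_cancel_left] at h
    · have h := hr j e
      rwa [ringConfig_snd_fst, inv_mul_cancel_left] at h
    · have h := hg x.1
      rwa [ringConfig_snd_snd_of_ne, one_mul, inv_mul_cancel_left] at h

/-! ## §2 The box in blow-up coordinates: the section of the periodic blow-up event -/

/-- For `δ ≤ r·t²` (`r ≥ 0`, `t > 0`): `M·√δ ≤ (M·√r)·t` for `M ≥ 0`. [folklore] -/
theorem mul_sqrt_le_of_le_mul_sq {δ r t M : ℝ} (hr : 0 ≤ r) (ht : 0 < t) (hM : 0 ≤ M) (hδ : δ ≤ r * t ^ 2) :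
    M * Real.sqrt δ ≤ M * Real.sqrt r * t := by
  have h1 : Real.sqrt δ ≤ Real.sqrt (r * t ^ 2) := Real.sqrt_le_sqrt hδ
  rw [Real.sqrt_mul hr, Real.sqrt_sq ht.le] at h1
  calc M * Real.sqrt δ ≤ M * (Real.sqrt r * t) := mul_le_mul_of_nonneg_left h1 hM
    _ = M * Real.sqrt r * t := by ring

/-- ★★ **THE SECTION OF THE PERIODIC BLOW-UP EVENT IS BOXED**: at scale `t > 0`, level `r·t²` (`r ≥ 0`), principal sector and `χ ≡ 1`, every `y` in the section
of `periodicBlowUpSet 0 1 t (r t²)` at `(a, w)` has all followers in the cone-model balls with `‖Q(D³_t y_i) − 1‖_F ≤ (12L²√r)·t`, AND the leaders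
`axialLetters (a, dil3P t w)` pairwise nearly commute up to `(20L²√r)·t` with `dil3P t w ∈ ball3`. [cite: Luscher1983, §2] -/
theorem section_periodicBlowUpSet_subset {r t : ℝ} (hr : 0 ≤ r) (ht : 0 < t) (a : ℍ) (w : (ℍ × ℍ) × ℍ) (y : Fol L → ℍ)
    (hy : y ∈ Prod.mk w ⁻¹' (Prod.mk a ⁻¹' periodicBlowUpSet L (fun _ => false) (fun _ => 1) t (r * t ^ 2))) :
    (∀ i, ‖dilateIm t (y i)‖ < 1 ∧
      frobNorm (((quatToSU2 (dilateIm t (y i)) : SU2) : Matrix (Fin 2) (Fin 2) ℂ) - 1) ≤ 12 * (L : ℝ) ^ 2 * Real.sqrt r * t) ∧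
    dil3P t w ∈ ball3 ∧ axialLetters (a, dil3P t w) ∈ nearlyCommuting (20 * (L : ℝ) ^ 2 * Real.sqrt r * t) := by
  simp only [Set.mem_preimage, periodicBlowUpSet, Set.mem_setOf_eq] at hy
  obtain ⟨hball, hballs, hdef⟩ := hy
  obtain ⟨hlead, hfol⟩ := periodicChartBox_of_chartDeficit (L := L) (periodicBlowUpPoint t (a, (w, y)))
  refine ⟨fun i => ⟨hballs i, ?_⟩, hball, fun k l => ?_⟩
  · exact (hfol i).trans (mul_sqrt_le_of_le_mul_sq hr ht (by positivity) hdef)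
  · exact (hlead k l).trans (mul_sqrt_le_of_le_mul_sq hr ht (by positivity) hdef)

/-- Outside the leader event the section is EMPTY. [folklore] -/
theorem section_periodicBlowUpSet_eq_empty {r t : ℝ} (hr : 0 ≤ r) (ht : 0 < t) (a : ℍ) (w : (ℍ × ℍ) × ℍ)
    (h : ¬ (dil3P t w ∈ ball3 ∧ axialLetters (a, dil3P t w) ∈ nearlyCommuting (20 * (L : ℝ) ^ 2 * Real.sqrt r * t))) :
    Prod.mk w ⁻¹' (Prod.mk a ⁻¹' periodicBlowUpSet L (fun _ => false) (fun _ => 1) t (r * t ^ 2)) = ∅ := by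
  ext y
  simp only [Set.mem_empty_iff_false, iff_false]
  intro hy
  exact h (section_periodicBlowUpSet_subset hr ht a w y hy).2

/-! ## §3 The follower section has volume at most the box volume -/

/-- The coordinate hyperplanes `{y | y i = 0}` are `vol^{Fol}`-null, so almost every follower tuple has all `D³_t y_i ≠ 0` (`t ≠ 0`). [folklore] -/
theorem ae_pi_dilateIm_ne_zero {t : ℝ} (ht : t ≠ 0) :
    ∀ᵐ y : Fol L → ℍ ∂(Measure.pi fun _ : Fol L => (volume : Measure ℍ)), ∀ i, dilateIm t (y i) ≠ 0 := by
  rw [ae_all_iff]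
  intro i
  have h0 : (Measure.pi fun _ : Fol L => (volume : Measure ℍ)) (Function.eval i ⁻¹' ({0} : Set ℍ)) = 0 :=
    Measure.pi_eval_preimage_null _ (measure_singleton (0 : ℍ))
  rw [ae_iff]
  refine measure_mono_null (fun y hy => ?_) h0
  simp only [ne_eq, not_not, Set.mem_setOf_eq] at hy
  simp only [Set.mem_preimage, Function.eval, Set.mem_singleton_iff]
  -- `D³_t (y i) = 0` forces `y i = 0` (`t ≠ 0`): real part and `t·Im` vanish
  have h1 : (dilateIm t (y i)).re = 0 ∧ (dilateIm t (y i)).imI = 0 ∧ (dilateIm t (y i)).imJ = 0 ∧ (dilateIm t (y i)).imK = 0 := by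
    rw [hy]; exact ⟨rfl, rfl, rfl, rfl⟩
  rw [ZeroModeSigma.dilateIm_re, ZeroModeSigma.dilateIm_imI, ZeroModeSigma.dilateIm_imJ, ZeroModeSigma.dilateIm_imK] at h1
  obtain ⟨h1, h2, h3, h4⟩ := h1
  exact Quaternion.ext _ _ h1 ((mul_eq_zero.1 h2).resolve_left ht) ((mul_eq_zero.1 h3).resolve_left ht) ((mul_eq_zero.1 h4).resolve_left ht)

/-- ★ **THE FOLLOWER SECTION IS BOXED, IN VOLUME**: for `t > 0`, `r ≥ 0`,
`vol^{Fol}(section of periodicBlowUpSet 0 1 t (r t²) at (a, w)) ≤ vol^{Fol}(Π_i {y | |y.re| < 1 ∧ ‖Im y‖ ≤ 12L²√r})` — uniformly in `t`, `a`, `w`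
(✓`BlowUp.follower_box` off the null set `∃ i, y_i = 0`). [folklore] -/
theorem volume_pi_followerSection_le {r t : ℝ} (hr : 0 ≤ r) (ht : 0 < t) (a : ℍ) (w : (ℍ × ℍ) × ℍ) :
    (Measure.pi fun _ : Fol L => (volume : Measure ℍ)) (Prod.mk w ⁻¹' (Prod.mk a ⁻¹' periodicBlowUpSet L (fun _ => false) (fun _ => 1) t (r * t ^ 2))) ≤
      (Measure.pi fun _ : Fol L => (volume : Measure ℍ)) (Set.univ.pi fun _ : Fol L => {y : ℍ | |y.re| < 1 ∧ ‖y.im‖ ≤ 12 * (L : ℝ) ^ 2 * Real.sqrt r}) := by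
  refine measure_mono_ae ?_
  filter_upwards [ae_pi_dilateIm_ne_zero (L := L) ht.ne'] with y hy0 hy
  obtain ⟨hfol, -⟩ := section_periodicBlowUpSet_subset hr ht a w y hy
  exact Set.mem_univ_pi.2 fun i => follower_box ht (by positivity) (hfol i).1 (hy0 i) (hfol i).2

/-- The box volume is finite (✓`pi_volume_followerBox_ne_top`). [folklore] -/
theorem volume_pi_followerBox_lt_top (r : ℝ) :
    (Measure.pi fun _ : Fol L => (volume : Measure ℍ)) (Set.univ.pi fun _ : Fol L => {y : ℍ | |y.re| < 1 ∧ ‖y.im‖ ≤ 12 * (L : ℝ) ^ 2 * Real.sqrt r}) < ∞ :=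
  lt_top_iff_ne_top.2 (pi_volume_followerBox_ne_top _)

/-- ★★ **THE PERIODIC FIBRE MASS IS DOMINATED BY (box volume) × (leader event)**: for `t > 0`, `r ≥ 0` and every hub `a`,
`Ψ_t(a) ≤ vol^{Fol}(box) · vol³{w | dil3P t w ∈ ball3 ∧ axialLetters (a, dil3P t w) ∈ nearlyCommuting ((20L²√r)·t)}`
(`Ψ_t = periodicFibreMass 0 1 t (r t²)`). [cite: Luscher1983, §2] -/
theorem periodicFibreMass_le_box_mul_leaderEvent {r t : ℝ} (hr : 0 ≤ r) (ht : 0 < t) (a : ℍ) :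
    periodicFibreMass L (fun _ => false) (fun _ => 1) t (r * t ^ 2) a ≤
      (Measure.pi fun _ : Fol L => (volume : Measure ℍ)) (Set.univ.pi fun _ : Fol L => {y : ℍ | |y.re| < 1 ∧ ‖y.im‖ ≤ 12 * (L : ℝ) ^ 2 * Real.sqrt r}) *
        (volume : Measure ((ℍ × ℍ) × ℍ)) {w | dil3P t w ∈ ball3 ∧ axialLetters (a, dil3P t w) ∈ nearlyCommuting (20 * (L : ℝ) ^ 2 * Real.sqrt r * t)} := by
  classical
  set V : ℝ≥0∞ := (Measure.pi fun _ : Fol L => (volume : Measure ℍ))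
    (Set.univ.pi fun _ : Fol L => {y : ℍ | |y.re| < 1 ∧ ‖y.im‖ ≤ 12 * (L : ℝ) ^ 2 * Real.sqrt r}) with hV
  set E : Set ((ℍ × ℍ) × ℍ) := {w | dil3P t w ∈ ball3 ∧ axialLetters (a, dil3P t w) ∈ nearlyCommuting (20 * (L : ℝ) ^ 2 * Real.sqrt r * t)} with hE
  unfold periodicFibreMass
  -- pointwise: the section measure is `≤ V · 𝟙_E(w)`
  have hpt : ∀ w, (Measure.pi fun _ : Fol L => (volume : Measure ℍ))
      (Prod.mk w ⁻¹' (Prod.mk a ⁻¹' periodicBlowUpSet L (fun _ => false) (fun _ => 1) t (r * t ^ 2))) ≤ E.indicator (fun _ => V) w := by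
    intro w
    by_cases hw : w ∈ E
    · rw [Set.indicator_of_mem hw]; exact volume_pi_followerSection_le hr ht a w
    · rw [Set.indicator_of_notMem hw, section_periodicBlowUpSet_eq_empty hr ht a w hw, measure_empty]
  calc ∫⁻ w, (Measure.pi fun _ : Fol L => (volume : Measure ℍ))
        (Prod.mk w ⁻¹' (Prod.mk a ⁻¹' periodicBlowUpSet L (fun _ => false) (fun _ => 1) t (r * t ^ 2))) ∂(volume : Measure ((ℍ × ℍ) × ℍ))
      ≤ ∫⁻ w, E.indicator (fun _ => V) w ∂(volume : Measure ((ℍ × ℍ) × ℍ)) := lintegral_mono hpt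
    _ ≤ V * (volume : Measure ((ℍ × ℍ) × ℍ)) E := lintegral_indicator_const_le _ _

end Summit.QuantumFields.YangMills.Theorems.SwapVirialDeficit.BlowUpRing

end
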